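import Literature.Analysis.FluidPDE.BoundedWeakTranslate
import Literature.Analysis.FluidPDE.ClassicalSolutionGalilean
import Literature.Analysis.FluidPDE.ClassicalSuitable
import Literature.Analysis.FluidPDE.HeatDuhamelBack
import Mathlib.MeasureTheory.Function.L2Space
import HarnessLib

/-!
# Galilean covariance of bounded weak Navier–Stokes solutions (KNSS 2009, §4 (ii))

Analysis/FluidPDE support file (all results proved, no definitions). The class of bounded weak
solutions of Koch–Nadirashvili–Seregin–Šverák (`IsBoundedWeakNSSolutionOn`, `KNSSLiouville`;
Acta Math. 203 (2009) = arXiv:0709.3599, §4 (ii): `u ∈ L^∞`, `div u = 0`,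
`∫∫ u·(∂ₜψ + (u·∇)ψ + νΔψ) = 0` for all smooth compactly supported divergence-free space–time
fields `ψ`) is invariant under time translations (`IsBoundedWeakNSSolutionOn.comp_add_right`),
space translations (`IsBoundedWeakNSSolutionOn.comp_add_space`, `BoundedWeakTranslate`) and
linear isometries (`IsBoundedWeakNSSolutionOn.conj_linearIsometryEquiv`, `BoundedWeakIsometry`).
This file proves its invariance under **Galilean boosts**: for every constant velocity `c`,

  `u ↦ u_c`, `u_c(t, y) = u(t, y + t c) − c`

(`IsBoundedWeakNSSolutionOn.galileanBoost`; with an arbitrary time origin,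
`IsBoundedWeakNSSolutionOn.galileanBoost_sub`). The tree already has the Galilean covariance of
classical solutions (`IsClassicalNSSolutionOn.galileanBoost_const`, where the pressure is
transported as a scalar) and of the drift-mild class (`IsKNSSDriftMild.galileanCovariance_R3`);
the weak class — the one in which KNSS's Liouville theorems 5.2–5.3 are DISCHARGED in the tree
(`KNSS2009_liouville_axisymmetric_no_swirl_holds`, `KNSS2009_liouville_bound_C_over_r_holds`) —
was missing. The sequel `KNSSLiouvilleGalileanFrame` composes the boost with Theorem 5.3: an
axisymmetric bounded ancient solution with `r |u − c e_z| ≤ C` is the constant `c e_z`.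

## Proof

Test `u_c` against `ψ` and substitute `y = x − t c` in each slice (Lebesgue measure is
translation invariant): the integrand becomes
`⟪u − c, (∂ₜψ)(t, x − tc)⟫ + ⟪u − c, Dψ(t, x − tc)[u − c]⟫ + ν⟪u − c, Δψ(t, x − tc)⟫` at
`(t, x)`. With the pulled-back test field `φ(t, x) = ψ(t, x − t c)` — again smooth, compactly
supported in the slab, with divergence-free slices (`IsSpaceTimeTestOn.galileanPull`) — the
chain rule along the moving point gives `(∂ₜψ)(t, x − tc) = ∂ₜφ(t, x) + Dφ(t, x)[c]`
(`timeDeriv_galileanPull`), while `Dψ(t, x − tc) = Dφ(t, x)`, `Δψ(t, x − tc) = Δφ(t, x)`. The two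
transport terms `± ⟪u − c, Dφ[c]⟫` cancel POINTWISE, leaving
`⟪u, ∂ₜφ + (u·∇)φ + νΔφ⟫ − ⟪c, ∂ₜφ + (u·∇)φ + νΔφ⟫`. The first bracket integrates to zero by the
weak identity for `u` tested against `φ`; in the second, `∫∫ ⟪c, ∂ₜφ⟫ = 0` (Fubini and the
fundamental theorem of calculus on each compactly supported time line), `∫ ⟪c, Dφ[u]⟫ dx = 0`
for a.e. `t` (this is `∫ ⟪u, ∇⟪c, φ⟫⟫ = 0`, the weak divergence constraint on the slice), and
`∫ ⟪c, Δφ⟫ dx = 0` (Green's identity against a constant). All splittings of integrals are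
justified on the slab, where the integrand is a bounded jointly measurable factor against
continuous compactly supported ones (no slice-wise measurability is used). Measurability and
the bound of `u_c` move along the measure-preserving shear `(t, y) ↦ (t, y + t c)`, and the
divergence constraint is translation invariant and insensitive to constants.

## Mathlib / tree search

Tree (`lean search 'galilean|Galilean' --decl`, `rg IsBoundedWeakNSSolutionOn`): Galilean
covariance exists for `IsClassicalNSSolutionOn` (`ClassicalSolutionGalilean`) and
`IsKNSSDriftMild` (`KNSSRegularityGalilean(Proofs)`), torus versions
(`TorusClassicalNSGalileanBoost`, `LerayHopfGalileanTorus*`), NOT for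
`IsBoundedWeakNSSolutionOn` (models used: `BoundedWeakTranslate`, `BoundedWeakIsometry`). Used
from the tree: the chain rule along a curve `IsSmoothSpaceTimeOn.hasDerivWithinAt_comp_curve`,
the pull-back calculus `stPull`/`fderiv_stPull`/`laplacian_stPull`/`divergence_stPull`
(`SpaceTimeRescaling`), `IsSpaceTimeTestOn.{hasDerivAt_time, hasCompactSupport_slice,
continuous_timeDeriv, continuous_fderiv_slice, timeDeriv_top, exists_time_support,
timeDeriv_eq_zero_of_notMem}`, `integral_inner_laplacian_add_eq_zero`,
`laplacian_eq_zero_of_notMem_tsupport` (`WholeSpaceIBP`), `IsWeaklyDivFree.comp_sub_right`,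
`VectorCalculus.IsDivFree.isWeaklyDivFree_holds`, `real_inner_gradient_right`. Mathlib:
`MeasurePreserving.skew_product`, `map_add_right_eq_self`, `integral_sub_right_eq_self`,
`integral_integral`, `integral_integral_swap`, `integral_eq_zero_of_hasDerivAt_of_integrable`,
`ContinuousLinearEquiv.equivOfInverse`, `fderiv_inner_apply`.

## References

* G. Koch, N. Nadirashvili, G. Seregin, V. Šverák, *Liouville theorems for the Navier–Stokes
  equations and applications*, Acta Math. 203 (2009) 83–105 = arXiv:0709.3599, §4 (ii), p. 8
  (bounded weak solutions). [KochNadirashviliSereginSverak2009]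
* A. J. Majda, A. L. Bertozzi, *Vorticity and Incompressible Flow*, CUP 2002, §1.2,
  Prop. 1.1 (i), eq. (1.9), p. 3 (Galilean invariance: `v_c(x, t) = v(x − ct, t) + c`,
  `p_c(x, t) = p(x − ct, t)`; here with velocity `−c`). [MajdaBertozziCUP2002]
-/

noncomputable section

open MeasureTheory Set Function Filter Topology TopologicalSpace InnerProductSpace
open scoped RealInnerProductSpace Laplacian ContDiff

namespace Literature.Analysis.FluidPDE

variable {E : Type*} [NormedAddCommGroup E] [InnerProductSpace ℝ E] [FiniteDimensional ℝ E]
  [MeasurableSpace E] [BorelSpace E]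

/-! ### The Galilean shear of space–time -/

/-- The Galilean shear `(t, y) ↦ (t, y + t c)` of space–time preserves Lebesgue measure (a skew
product of translations over the identity of the time axis). [folklore] -/
private theorem measurePreserving_galileanShear (c : E) :
    MeasurePreserving (fun p : ℝ × E => (p.1, p.2 + p.1 • c))
      (volume : Measure (ℝ × E)) volume := by
  have hgm : Measurable (uncurry fun (t : ℝ) (y : E) => y + t • c) :=
    (continuous_snd.add (continuous_fst.smul continuous_const)).measurable
  have h := (MeasurePreserving.id (volume : Measure ℝ)).skew_product
    (g := fun (t : ℝ) (y : E) => y + t • c) hgm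
    (Eventually.of_forall fun t => map_add_right_eq_self (volume : Measure E) (t • c))
  rw [← Measure.volume_eq_prod] at h
  exact h

/-- The Galilean shear preserves the restriction of Lebesgue measure to any slab `I × E`. [folklore] -/
private theorem measurePreserving_galileanShear_slab (c : E) (I : Set ℝ) (hI : MeasurableSet I) :
    MeasurePreserving (fun p : ℝ × E => (p.1, p.2 + p.1 • c))
      ((volume : Measure (ℝ × E)).restrict (I ×ˢ univ))
      ((volume : Measure (ℝ × E)).restrict (I ×ˢ univ)) := by
  have hpre : (fun p : ℝ × E => (p.1, p.2 + p.1 • c)) ⁻¹' (I ×ˢ (univ : Set E)) = I ×ˢ univ := by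
    ext p
    simp
  have h := (measurePreserving_galileanShear c).restrict_preimage (hI.prod MeasurableSet.univ)
  rwa [hpre] at h

/-- The slab measure as a product: `vol|_I ⊗ vol = vol|_{I × E}`. [folklore] -/
private theorem volume_restrict_prod_volume_eq_restrict_slab (I : Set ℝ) :
    ((volume : Measure ℝ).restrict I).prod (volume : Measure E) =
      (volume : Measure (ℝ × E)).restrict (I ×ˢ univ) := by
  rw [Measure.restrict_prod_eq_prod_univ, ← Measure.volume_eq_prod]

/-! ### The divergence constraint is insensitive to constants -/

/-- Subtracting a constant preserves weak divergence-freeness: `∫ ⟪v − c, ∇θ⟫ = ∫ ⟪v, ∇θ⟫ − 0`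
(the constant field is divergence free; if `⟪v, ∇θ⟫` is not integrable neither is
`⟪v − c, ∇θ⟫`, and both integrals are Mathlib's junk `0`). [folklore] -/
private theorem IsWeaklyDivFree.sub_const {v : E → E} (hv : IsWeaklyDivFree v) (c : E) :
    IsWeaklyDivFree (fun x => v x - c) := by
  haveI : CompleteSpace E := FiniteDimensional.complete ℝ E
  intro θ hθ
  have hc : ∫ x, ⟪c, gradient θ x⟫ = (0 : ℝ) :=
    VectorCalculus.IsDivFree.isWeaklyDivFree_holds (u := fun _ : E => c)
      (fun x => by simp [VectorCalculus.divergence]) contDiff_const θ hθ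
  have hgc : Continuous (gradient θ) :=
    (InnerProductSpace.toDual ℝ E).symm.continuous.comp (hθ.contDiff.continuous_fderiv (by simp))
  have hgs : HasCompactSupport (gradient θ) :=
    (hθ.hasCompactSupport.fderiv (𝕜 := ℝ)).comp_left (g := (InnerProductSpace.toDual ℝ E).symm)
      (map_zero _)
  have hci : Integrable (fun x => ⟪c, gradient θ x⟫) (volume : Measure E) :=
    (hgc.integrable_of_hasCompactSupport hgs).const_inner c
  have hpt : (fun x => ⟪v x - c, gradient θ x⟫) =
      fun x => ⟪v x, gradient θ x⟫ - ⟪c, gradient θ x⟫ := by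
    funext x
    rw [inner_sub_left]
  rw [hpt]
  by_cases hi : Integrable (fun x => ⟪v x, gradient θ x⟫) (volume : Measure E)
  · rw [integral_sub hi hci, hv θ hθ, hc, sub_zero]
  · have hni : ¬ Integrable (fun x => ⟪v x, gradient θ x⟫ - ⟪c, gradient θ x⟫)
        (volume : Measure E) := by
      intro h
      apply hi
      simpa [Pi.add_def] using h.add hci
    exact integral_undef hni

/-! ### The pulled-back test field `φ(t, x) = ψ(t, x − t c)` -/

section TestField

variable {F : Type*} [NormedAddCommGroup F] [NormedSpace ℝ F]

omit [MeasurableSpace E] [BorelSpace E] [FiniteDimensional ℝ E] in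
/-- **Pull-back of space–time test fields along a Galilean shear.** If `ψ` is a space–time test
field on the slab `I × E`, so is `(t, x) ↦ ψ(t, x − t c)` (composition with the linear
automorphism `(t, x) ↦ (t, x − t c)` of space–time, which preserves every slab). [folklore] -/
private theorem IsSpaceTimeTestOn.galileanPull {I : Set ℝ} {hI : IsOpen I} {ψ : ℝ → E → F}
    (hψ : IsSpaceTimeTestOn (slab E I hI) ψ) (c : E) :
    IsSpaceTimeTestOn (slab E I hI) (fun t x => ψ t (x - t • c)) := by
  set A : (ℝ × E) →L[ℝ] (ℝ × E) := (ContinuousLinearMap.fst ℝ ℝ E).prod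
    (ContinuousLinearMap.snd ℝ ℝ E - (ContinuousLinearMap.fst ℝ ℝ E).smulRight c) with hA
  set B : (ℝ × E) →L[ℝ] (ℝ × E) := (ContinuousLinearMap.fst ℝ ℝ E).prod
    (ContinuousLinearMap.snd ℝ ℝ E + (ContinuousLinearMap.fst ℝ ℝ E).smulRight c) with hB
  have hA' : ∀ p : ℝ × E, A p = (p.1, p.2 - p.1 • c) := fun p => by
    simp [hA]
  have hB' : ∀ p : ℝ × E, B p = (p.1, p.2 + p.1 • c) := fun p => by
    simp [hB]
  set Φ : (ℝ × E) ≃L[ℝ] (ℝ × E) := ContinuousLinearEquiv.equivOfInverse A B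
    (fun p => by rw [hB', hA']; simp) (fun p => by rw [hA', hB']; simp) with hΦ
  have hΦ' : ∀ p : ℝ × E, Φ p = (p.1, p.2 - p.1 • c) := fun p => hA' p
  have heq : uncurry (fun t x => ψ t (x - t • c)) = uncurry ψ ∘ Φ := by
    funext p
    obtain ⟨t, x⟩ := p
    simp [hΦ']
  refine ⟨?_, ?_, ?_⟩
  · rw [heq]
    exact hψ.contDiff.comp Φ.contDiff
  · rw [heq]
    exact hψ.hasCompactSupport.comp_homeomorph Φ.toHomeomorph
  · rw [heq, show (uncurry ψ ∘ ⇑Φ) = uncurry ψ ∘ ⇑Φ.toHomeomorph from rfl,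
      tsupport_comp_eq_preimage]
    intro q hq
    have h1 : Φ.toHomeomorph q ∈ (slab E I hI : Set (ℝ × E)) := hψ.tsupport_subset hq
    rw [SetLike.mem_coe, mem_slab] at h1 ⊢
    have h2 : (Φ.toHomeomorph q).1 = q.1 := by
      change (Φ q).1 = q.1
      rw [hΦ']
    rwa [h2] at h1

omit [MeasurableSpace E] [BorelSpace E] [FiniteDimensional ℝ E] [NormedAddCommGroup F]
  [NormedSpace ℝ F] in
/-- The slice at time `t` of the pulled-back field is the space translate by `−t c` of the slice
of `ψ`, in the tree's `stPull` notation. [folklore] -/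
private theorem slice_galileanPull_eq_stPull (ψ : ℝ → E → F) (c : E) (t : ℝ) :
    (fun x => ψ t (x - t • c)) = stPull 1 1 0 (-(t • c)) ψ t := by
  funext x
  simp [stPull_apply, neg_add_eq_sub]

omit [MeasurableSpace E] [BorelSpace E] [FiniteDimensional ℝ E] in
/-- Space derivative of the pulled-back slice: `D(ψ(t, · − tc))(x) = Dψ(t, ·)(x − tc)`. [folklore] -/
private theorem fderiv_slice_galileanPull (ψ : ℝ → E → F) (c : E) (t : ℝ) (x : E) :
    fderiv ℝ (fun x => ψ t (x - t • c)) x = fderiv ℝ (ψ t) (x - t • c) := by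
  rw [slice_galileanPull_eq_stPull, fderiv_stPull]
  simp [neg_add_eq_sub]

omit [MeasurableSpace E] [BorelSpace E] in
/-- Laplacian of the pulled-back slice: `Δ(ψ(t, · − tc))(x) = Δψ(t, ·)(x − tc)` (`C²` slice). [folklore] -/
private theorem laplacian_slice_galileanPull {ψ : ℝ → E → F} (c : E) (t : ℝ) (x : E)
    (h2 : ContDiff ℝ 2 (ψ t)) :
    (Δ (fun x => ψ t (x - t • c))) x = (Δ (ψ t)) (x - t • c) := by
  have h2' : ContDiff ℝ 2 (ψ (0 + 1 * t)) := by
    simpa using h2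
  rw [slice_galileanPull_eq_stPull, laplacian_stPull 1 1 0 (-(t • c)) ψ t x h2']
  simp [neg_add_eq_sub]

omit [MeasurableSpace E] [BorelSpace E] in
/-- Divergence of the pulled-back slice of a vector test field:
`div(ψ(t, · − tc))(x) = div ψ(t, ·)(x − tc)`. [folklore] -/
private theorem divergence_slice_galileanPull (ψ : ℝ → E → E) (c : E) (t : ℝ) (x : E) :
    VectorCalculus.divergence (fun x => ψ t (x - t • c)) x =
      VectorCalculus.divergence (ψ t) (x - t • c) := by
  rw [slice_galileanPull_eq_stPull, divergence_stPull]
  simp [neg_add_eq_sub]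

omit [MeasurableSpace E] [BorelSpace E] [FiniteDimensional ℝ E] in
/-- **Time derivative of the pulled-back field** (chain rule along the moving point
`s ↦ x − s c`): `∂ₜ(ψ(t, x − tc)) = (∂ₜψ)(t, x − tc) − Dψ(t, ·)(x − tc)[c]`. [folklore] -/
private theorem timeDeriv_galileanPull {Q : Opens (ℝ × E)} {ψ : ℝ → E → F}
    (hψ : IsSpaceTimeTestOn Q ψ) (c : E) (t : ℝ) (x : E) :
    timeDeriv (fun t x => ψ t (x - t • c)) t x =
      timeDeriv ψ t (x - t • c) - fderiv ℝ (ψ t) (x - t • c) c := by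
  have hγ : HasDerivWithinAt (fun s : ℝ => x - s • c) (-c) univ t := by
    have h := HasDerivAt.const_sub x ((hasDerivAt_id t).smul_const c)
    simp only [id_eq, one_smul] at h
    exact h.hasDerivWithinAt
  have key := (hψ.isSmoothSpaceTimeOn univ).hasDerivWithinAt_comp_curve (mem_univ t)
    uniqueDiffWithinAt_univ hγ
  rw [hasDerivWithinAt_univ] at key
  rw [timeDeriv_apply, key.deriv, ← timeDeriv_eq_timeDerivWithin_univ, map_neg]
  abel

end TestField

/-! ### Integrability on the slab -/

/-- A bounded, a.e. strongly measurable factor against an a.e. strongly measurable factor with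
integrable norm gives an integrable inner product. [folklore] -/
private theorem integrable_inner_of_norm_le_ae_aux {X : Type*} [MeasurableSpace X] {μ : Measure X}
    {F' : Type*} [NormedAddCommGroup F'] [InnerProductSpace ℝ F']
    {U G : X → F'} (hU : AEStronglyMeasurable U μ) {C : ℝ} (hC : ∀ᵐ p ∂μ, ‖U p‖ ≤ C)
    (hGm : AEStronglyMeasurable G μ) (hGi : Integrable (fun p => ‖G p‖) μ) :
    Integrable (fun p => ⟪U p, G p⟫) μ := by
  refine (hGi.const_mul C).mono' (hU.inner hGm) ?_
  filter_upwards [hC] with p hp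
  calc ‖⟪U p, G p⟫‖ ≤ ‖U p‖ * ‖G p‖ := norm_inner_le_norm _ _
    _ ≤ C * ‖G p‖ := mul_le_mul_of_nonneg_right hp (norm_nonneg _)

omit [MeasurableSpace E] [BorelSpace E] [InnerProductSpace ℝ E] [FiniteDimensional ℝ E] in
/-- Off the support of a space–time field, the point of the slice is off the support of the
slice. [folklore] -/
private theorem notMem_tsupport_slice_aux {F : Type*} [NormedAddCommGroup F]
    {ψ : ℝ → E → F} {t : ℝ} {x : E} (h : (t, x) ∉ tsupport (uncurry ψ)) :
    x ∉ tsupport (ψ t) := by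
  rw [notMem_tsupport_iff_eventuallyEq] at h ⊢
  have hc : Continuous fun y : E => ((t, y) : ℝ × E) := continuous_const.prodMk continuous_id
  exact (hc.tendsto x).eventually h

/-! ### Galilean covariance of the class -/

/-- **Galilean covariance of bounded weak Navier–Stokes solutions** (KNSS 2009, §4 (ii): the
class of bounded weak solutions on `ℝⁿ × I`; Majda–Bertozzi 2002, Prop. 1.1 (i), Galilean
invariance, here for KNSS's weak class). If `u` is a bounded weak solution on the open time set
`I` with viscosity `ν`, then for every constant velocity `c` the boosted field
`(t, y) ↦ u(t, y + t c) − c` is a bounded weak solution on `I` with viscosity `ν` (Majda–Bertozzi's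
(1.9), `v_c(x, t) = v(x − ct, t) + c`, with velocity `−c`). [cite: MajdaBertozziCUP2002, §1.2 Prop. 1.1 (i) eq. (1.9) (p. 3); KochNadirashviliSereginSverak2009 §4 (ii) p. 8] -/
theorem IsBoundedWeakNSSolutionOn.galileanBoost {I : Set ℝ} {hI : IsOpen I} {ν : ℝ}
    {u : ℝ → E → E} (h : IsBoundedWeakNSSolutionOn I hI ν u) (c : E) :
    IsBoundedWeakNSSolutionOn I hI ν (fun t y => u t (y + t • c) - c) := by
  haveI : CompleteSpace E := FiniteDimensional.complete ℝ E
  obtain ⟨hmeas, ⟨C, hC⟩, hdiv, hweak⟩ := h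
  refine ⟨?_, ⟨C + ‖c‖, fun t ht y => ?_⟩, ?_, fun ψ hψ hψdiv => ?_⟩
  · -- measurability on the slab, along the measure-preserving shear
    have heq : uncurry (fun t y => u t (y + t • c) - c) =
        (fun w : E => w - c) ∘ uncurry u ∘ (fun p : ℝ × E => (p.1, p.2 + p.1 • c)) := by
      funext p
      obtain ⟨t, y⟩ := p
      rfl
    rw [heq]
    exact (continuous_id.sub continuous_const).comp_aestronglyMeasurable
      (hmeas.comp_measurePreserving (measurePreserving_galileanShear_slab c I hI.measurableSet))
  · -- the bound
    calc ‖u t (y + t • c) - c‖ ≤ ‖u t (y + t • c)‖ + ‖c‖ := norm_sub_le _ _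
      _ ≤ C + ‖c‖ := add_le_add (hC t ht _) le_rfl
  · -- the divergence constraint
    filter_upwards [hdiv] with t ht
    have h1 := (ht.comp_sub_right (-(t • c))).sub_const c
    have e : (fun y => u t (y - -(t • c)) - c) = fun y => u t (y + t • c) - c := by
      funext y
      rw [sub_neg_eq_add]
    rwa [e] at h1
  · -- the weak identity
    set φ : ℝ → E → E := fun t x => ψ t (x - t • c) with hφdef
    have hφ : IsSpaceTimeTestOn (slab E I hI) φ := hψ.galileanPull c
    have hφdiv : ∀ t, VectorCalculus.IsDivFree (φ t) := by
      intro t x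
      have e : VectorCalculus.divergence (φ t) x =
          VectorCalculus.divergence (ψ t) (x - t • c) := divergence_slice_galileanPull ψ c t x
      rw [e]
      exact hψdiv t _
    have key := hweak φ hφ hφdiv
    -- the calculus of the pulled-back test field
    have hfd : ∀ t x, fderiv ℝ (φ t) x = fderiv ℝ (ψ t) (x - t • c) := fun t x =>
      fderiv_slice_galileanPull ψ c t x
    have hlap : ∀ t x, (Δ (φ t)) x = (Δ (ψ t)) (x - t • c) := fun t x =>
      laplacian_slice_galileanPull c t x (hψ.contDiff_slice_two t)
    have htd : ∀ t x, timeDeriv φ t x =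
        timeDeriv ψ t (x - t • c) - fderiv ℝ (ψ t) (x - t • c) c := fun t x =>
      timeDeriv_galileanPull hψ c t x
    -- the three test quantities of `φ` on space–time: continuous, supported in `tsupport φ`
    have hK : IsCompact (tsupport (uncurry φ)) := hφ.hasCompactSupport
    have hT₁c : Continuous fun p : ℝ × E => timeDeriv φ p.1 p.2 := hφ.continuous_timeDeriv
    have hT₁s : HasCompactSupport fun p : ℝ × E => timeDeriv φ p.1 p.2 :=
      HasCompactSupport.intro hK fun p hp => IsSpaceTimeTestOn.timeDeriv_eq_zero_of_notMem hp
    have hT₂c : Continuous fun p : ℝ × E => fderiv ℝ (φ p.1) p.2 := hφ.continuous_fderiv_slice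
    have hT₂s : HasCompactSupport fun p : ℝ × E => fderiv ℝ (φ p.1) p.2 :=
      HasCompactSupport.intro hK fun p hp =>
        fderiv_of_notMem_tsupport ℝ (notMem_tsupport_slice_aux hp)
    have hT₃c : Continuous fun p : ℝ × E => (Δ (φ p.1)) p.2 := hφ.continuous_laplacian_slice
    have hT₃s : HasCompactSupport fun p : ℝ × E => (Δ (φ p.1)) p.2 :=
      HasCompactSupport.intro hK fun p hp =>
        laplacian_eq_zero_of_notMem_tsupport (notMem_tsupport_slice_aux hp)
    -- the slab measure, the joint measurability and the bound of `u` on it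
    set μ : Measure (ℝ × E) := (volume : Measure (ℝ × E)).restrict (I ×ˢ univ) with hμdef
    have hμ : ((volume : Measure ℝ).restrict I).prod (volume : Measure E) = μ :=
      volume_restrict_prod_volume_eq_restrict_slab I
    have hUm : AEStronglyMeasurable (fun p : ℝ × E => u p.1 p.2) μ := hmeas
    have hUC : ∀ᵐ p ∂μ, ‖u p.1 p.2‖ ≤ C := by
      filter_upwards [ae_restrict_mem (hI.measurableSet.prod MeasurableSet.univ)] with p hp
      exact hC p.1 (mem_prod.1 hp).1 p.2
    have hT₁i : Integrable (fun p : ℝ × E => timeDeriv φ p.1 p.2) μ :=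
      (hT₁c.integrable_of_hasCompactSupport hT₁s).restrict
    have hT₂i : Integrable (fun p : ℝ × E => fderiv ℝ (φ p.1) p.2) μ :=
      (hT₂c.integrable_of_hasCompactSupport hT₂s).restrict
    have hT₃i : Integrable (fun p : ℝ × E => (Δ (φ p.1)) p.2) μ :=
      (hT₃c.integrable_of_hasCompactSupport hT₃s).restrict
    -- the field `Dφ[u]` on the slab
    have hDm : AEStronglyMeasurable (fun p : ℝ × E => fderiv ℝ (φ p.1) p.2 (u p.1 p.2)) μ :=
      Continuous.comp_aestronglyMeasurable₂ (g := fun (L : E →L[ℝ] E) (v : E) => L v)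
        isBoundedBilinearMap_apply.continuous hT₂c.aestronglyMeasurable hUm
    have hDi : Integrable (fun p : ℝ × E => ‖fderiv ℝ (φ p.1) p.2 (u p.1 p.2)‖) μ := by
      refine (hT₂i.norm.mul_const C).mono' hDm.norm ?_
      filter_upwards [hUC] with p hp
      rw [norm_norm]
      calc ‖fderiv ℝ (φ p.1) p.2 (u p.1 p.2)‖ ≤ ‖fderiv ℝ (φ p.1) p.2‖ * ‖u p.1 p.2‖ :=
            (fderiv ℝ (φ p.1) p.2).le_opNorm _
        _ ≤ ‖fderiv ℝ (φ p.1) p.2‖ * C := mul_le_mul_of_nonneg_left hp (norm_nonneg _)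
    -- the six slab integrands
    set a₁ : ℝ → E → ℝ := fun t x => ⟪u t x, timeDeriv φ t x⟫ with ha₁
    set a₂ : ℝ → E → ℝ := fun t x => ⟪u t x, fderiv ℝ (φ t) x (u t x)⟫ with ha₂
    set a₃ : ℝ → E → ℝ := fun t x => ⟪u t x, (Δ (φ t)) x⟫ with ha₃
    set b₁ : ℝ → E → ℝ := fun t x => ⟪c, timeDeriv φ t x⟫ with hb₁
    set b₂ : ℝ → E → ℝ := fun t x => ⟪c, fderiv ℝ (φ t) x (u t x)⟫ with hb₂
    set b₃ : ℝ → E → ℝ := fun t x => ⟪c, (Δ (φ t)) x⟫ with hb₃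
    have ia₁ : Integrable (uncurry a₁) μ :=
      integrable_inner_of_norm_le_ae_aux hUm hUC hT₁i.1 hT₁i.norm
    have ia₂ : Integrable (uncurry a₂) μ :=
      integrable_inner_of_norm_le_ae_aux hUm hUC hDm hDi
    have ia₃ : Integrable (uncurry a₃) μ :=
      integrable_inner_of_norm_le_ae_aux hUm hUC hT₃i.1 hT₃i.norm
    have ib₁ : Integrable (uncurry b₁) μ := hT₁i.const_inner c
    have ib₂ : Integrable (uncurry b₂) μ := by
      refine (hDi.const_mul ‖c‖).mono' (aestronglyMeasurable_const.inner hDm) ?_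
      exact Eventually.of_forall fun p => norm_inner_le_norm _ _
    have ib₃ : Integrable (uncurry b₃) μ := hT₃i.const_inner c
    set a : ℝ → E → ℝ := fun t x => a₁ t x + a₂ t x + ν * a₃ t x with ha
    set b : ℝ → E → ℝ := fun t x => b₁ t x + b₂ t x + ν * b₃ t x with hb
    have ia : Integrable (uncurry a) μ := (ia₁.add ia₂).add (ia₃.const_mul ν)
    have ib : Integrable (uncurry b) μ := (ib₁.add ib₂).add (ib₃.const_mul ν)
    have ia' : Integrable (fun z : ℝ × E => a z.1 z.2)
        (((volume : Measure ℝ).restrict I).prod volume) := by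
      rw [hμ]; exact ia
    have ib' : Integrable (fun z : ℝ × E => b z.1 z.2)
        (((volume : Measure ℝ).restrict I).prod volume) := by
      rw [hμ]; exact ib
    have iab' : Integrable (fun z : ℝ × E => a z.1 z.2 - b z.1 z.2)
        (((volume : Measure ℝ).restrict I).prod volume) := ia'.sub ib'
    -- (1) the weak identity for `u` tested against `φ`
    have i₁ : ∫ t in I, ∫ x, a t x = 0 := by
      simpa only [ha, ha₁, ha₂, ha₃, convect_apply] using key
    -- (2) the three `c`-terms integrate to zero
    have ib₁' : Integrable (fun z : ℝ × E => b₁ z.1 z.2)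
        (((volume : Measure ℝ).restrict I).prod volume) := by
      rw [hμ]; exact ib₁
    have ib₂' : Integrable (fun z : ℝ × E => b₂ z.1 z.2)
        (((volume : Measure ℝ).restrict I).prod volume) := by
      rw [hμ]; exact ib₂
    have ib₃' : Integrable (fun z : ℝ × E => b₃ z.1 z.2)
        (((volume : Measure ℝ).restrict I).prod volume) := by
      rw [hμ]; exact ib₃
    -- (2a) `∫∫ ⟪c, ∂ₜφ⟫ = 0`: Fubini and the fundamental theorem of calculus on each time line
    have j₁ : ∫ t in I, ∫ x, b₁ t x = 0 := by
      rw [integral_integral_swap ib₁']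
      refine (integral_congr_ae (Eventually.of_forall fun x => ?_)).trans (integral_zero _ _)
      obtain ⟨t₁, t₂, h₁₂⟩ := (hφ.mono le_top).exists_time_support
      obtain ⟨s₁, s₂, hs₁₂⟩ := (hφ.mono le_top).timeDeriv_top.exists_time_support
      have hout : ∀ t, t ∉ I → timeDeriv φ t x = 0 := by
        intro t ht
        refine IsSpaceTimeTestOn.timeDeriv_eq_zero_of_notMem fun hmem => ht ?_
        have := hφ.tsupport_subset hmem
        rw [SetLike.mem_coe, mem_slab] at this
        exact this
      have hline : Continuous fun t : ℝ => φ t x :=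
        hφ.contDiff.continuous.comp (continuous_id.prodMk continuous_const)
      have hline' : Continuous fun t : ℝ => timeDeriv φ t x :=
        hT₁c.comp (continuous_id.prodMk continuous_const)
      have hφi : Integrable (fun t : ℝ => φ t x) (volume : Measure ℝ) :=
        hline.integrable_of_hasCompactSupport
          (HasCompactSupport.intro isCompact_Icc fun t ht => by
            rw [h₁₂ t ht]
            rfl)
      have hφ'i : Integrable (fun t : ℝ => timeDeriv φ t x) (volume : Measure ℝ) :=
        hline'.integrable_of_hasCompactSupport
          (HasCompactSupport.intro isCompact_Icc fun t ht => by
            rw [hs₁₂ t ht]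
            rfl)
      change ∫ t in I, ⟪c, timeDeriv φ t x⟫ = 0
      rw [setIntegral_eq_integral_of_forall_compl_eq_zero fun t ht => by
        rw [hout t ht, inner_zero_right], integral_inner hφ'i c,
        integral_eq_zero_of_hasDerivAt_of_integrable (fun t => hφ.hasDerivAt_time t x) hφ'i hφi,
        inner_zero_right]
    -- (2b) `∫ ⟪c, Dφ[u]⟫ dx = 0` for a.e. `t`: the divergence constraint tested with `⟪c, φ(t)⟫`
    have j₂ : ∫ t in I, ∫ x, b₂ t x = 0 := by
      refine (integral_congr_ae ?_).trans (integral_zero _ _)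
      filter_upwards [hdiv] with t ht
      have hθ : FunctionSpaces.IsTestFunctionOn (⊤ : Opens E) (fun x => ⟪c, φ t x⟫) :=
        ⟨contDiff_const.inner ℝ (hφ.contDiff_slice t),
          (hφ.hasCompactSupport_slice t).comp_left (g := fun v : E => ⟪c, v⟫)
            (inner_zero_right c),
          fun _ _ => trivial⟩
      have h0 := ht _ hθ
      have hpt : ∀ x, ⟪u t x, gradient (fun x => ⟪c, φ t x⟫) x⟫ = b₂ t x := by
        intro x
        rw [real_inner_gradient_right, hb₂]
        simp only
        rw [fderiv_inner_apply ℝ (differentiableAt_const c)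
          ((hφ.contDiff_slice t).differentiable (by simp) x)]
        simp
      simpa only [hpt] using h0
    -- (2c) `∫ ⟪c, Δφ⟫ dx = 0` for every `t`: Green's identity against a constant
    have j₃ : ∫ t in I, ∫ x, b₃ t x = 0 := by
      refine (setIntegral_congr_fun hI.measurableSet fun t _ => ?_).trans (integral_zero _ _)
      have hg := integral_inner_laplacian_add_eq_zero (stdOrthonormalBasis ℝ E)
        (v := φ t) (w := fun _ : E => c) (hφ.contDiff_slice_two t) contDiff_const
        (Or.inl (hφ.hasCompactSupport_slice t))
      have hsum : ∑ i, ∫ x, ⟪fderiv ℝ (φ t) x (stdOrthonormalBasis ℝ E i),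
          fderiv ℝ (fun _ : E => c) x (stdOrthonormalBasis ℝ E i)⟫ = 0 := by
        simp
      rw [hsum, add_zero] at hg
      change ∫ x, ⟪c, (Δ (φ t)) x⟫ = 0
      calc ∫ x, ⟪c, (Δ (φ t)) x⟫ = ∫ x, ⟪(Δ (φ t)) x, c⟫ := by
            congr 1
            funext x
            exact real_inner_comm _ _
        _ = 0 := hg
    have i₂ : ∫ t in I, ∫ x, b t x = 0 := by
      calc ∫ t in I, ∫ x, b t x
          = ∫ z, b z.1 z.2 ∂(((volume : Measure ℝ).restrict I).prod volume) :=
            integral_integral ib'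
        _ = (∫ z, (b₁ z.1 z.2 + b₂ z.1 z.2) ∂(((volume : Measure ℝ).restrict I).prod volume)) +
              ∫ z, ν * b₃ z.1 z.2 ∂(((volume : Measure ℝ).restrict I).prod volume) :=
            integral_add (ib₁'.add ib₂') (ib₃'.const_mul ν)
        _ = (∫ z, b₁ z.1 z.2 ∂(((volume : Measure ℝ).restrict I).prod volume)) +
              (∫ z, b₂ z.1 z.2 ∂(((volume : Measure ℝ).restrict I).prod volume)) +
              ν * ∫ z, b₃ z.1 z.2 ∂(((volume : Measure ℝ).restrict I).prod volume) := by
            rw [integral_add ib₁' ib₂', MeasureTheory.integral_const_mul]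
        _ = 0 := by
            rw [← integral_integral ib₁', ← integral_integral ib₂', ← integral_integral ib₃',
              j₁, j₂, j₃]
            ring
    -- (3) the integrand of the boosted field, slice by slice, after `y = x − t c`
    have hpt : ∀ t x, ⟪u t x - c, timeDeriv ψ t (x - t • c)⟫ +
        ⟪u t x - c, fderiv ℝ (ψ t) (x - t • c) (u t x - c)⟫ +
        ν * ⟪u t x - c, (Δ (ψ t)) (x - t • c)⟫ = a t x - b t x := by
      intro t x
      have e₁ : timeDeriv ψ t (x - t • c) = timeDeriv φ t x + fderiv ℝ (φ t) x c := by
        rw [htd, hfd]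
        abel
      have e₂ : fderiv ℝ (ψ t) (x - t • c) = fderiv ℝ (φ t) x := (hfd t x).symm
      have e₃ : (Δ (ψ t)) (x - t • c) = (Δ (φ t)) x := (hlap t x).symm
      rw [e₁, e₂, e₃, map_sub]
      simp only [ha, hb, ha₁, ha₂, ha₃, hb₁, hb₂, hb₃, inner_add_right, inner_sub_left,
        inner_sub_right]
      ring
    have hG : ∀ t, (∫ y, (⟪u t (y + t • c) - c, timeDeriv ψ t y⟫ +
        ⟪u t (y + t • c) - c, fderiv ℝ (ψ t) y (u t (y + t • c) - c)⟫ +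
        ν * ⟪u t (y + t • c) - c, (Δ (ψ t)) y⟫)) = ∫ x, (a t x - b t x) := by
      intro t
      have htr := integral_sub_right_eq_self (μ := (volume : Measure E))
        (fun y : E => (⟪u t (y + t • c) - c, timeDeriv ψ t y⟫ +
          ⟪u t (y + t • c) - c, fderiv ℝ (ψ t) y (u t (y + t • c) - c)⟫ +
          ν * ⟪u t (y + t • c) - c, (Δ (ψ t)) y⟫ : ℝ)) (t • c)
      rw [← htr]
      refine integral_congr_ae (Eventually.of_forall fun x => ?_)
      simp only [sub_add_cancel]
      exact hpt t x
    -- (4) assemble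
    simp only [convect_apply]
    calc ∫ t in I, ∫ y, (⟪u t (y + t • c) - c, timeDeriv ψ t y⟫ +
          ⟪u t (y + t • c) - c, fderiv ℝ (ψ t) y (u t (y + t • c) - c)⟫ +
          ν * ⟪u t (y + t • c) - c, (Δ (ψ t)) y⟫)
        = ∫ t in I, ∫ x, (a t x - b t x) :=
          setIntegral_congr_fun hI.measurableSet fun t _ => hG t
      _ = ∫ z, (a z.1 z.2 - b z.1 z.2) ∂(((volume : Measure ℝ).restrict I).prod volume) :=
          integral_integral iab'
      _ = (∫ z, a z.1 z.2 ∂(((volume : Measure ℝ).restrict I).prod volume)) -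
            ∫ z, b z.1 z.2 ∂(((volume : Measure ℝ).restrict I).prod volume) :=
          integral_sub ia' ib'
      _ = 0 := by
          rw [← integral_integral ia', ← integral_integral ib', i₁, i₂, sub_zero]

/-- **Galilean covariance with an arbitrary time origin**: `(t, y) ↦ u(t, y + (t − t₀) c) − c`
is again a bounded weak solution (the boost composed with the space translation by `−t₀ c`). [cite: MajdaBertozziCUP2002, §1.2 Prop. 1.1 (i) eq. (1.9) (p. 3)] -/
theorem IsBoundedWeakNSSolutionOn.galileanBoost_sub {I : Set ℝ} {hI : IsOpen I} {ν : ℝ}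
    {u : ℝ → E → E} (h : IsBoundedWeakNSSolutionOn I hI ν u) (c : E) (t₀ : ℝ) :
    IsBoundedWeakNSSolutionOn I hI ν (fun t y => u t (y + (t - t₀) • c) - c) := by
  have h1 := (h.galileanBoost c).comp_add_space (-(t₀ • c))
  have e : (fun t y => u t (-(t₀ • c) + y + t • c) - c) =
      fun t y => u t (y + (t - t₀) • c) - c := by
    funext t y
    rw [sub_smul, neg_add_eq_sub, sub_add_eq_add_sub, add_sub_assoc]
  rw [← e]
  exact h1

/-- The inverse boost: `u` is recovered from `u_c` by the boost with velocity `−c`, so the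
class is invariant (not merely mapped into itself) — Majda–Bertozzi's "symmetry group". [cite: MajdaBertozziCUP2002, §1.2 Prop. 1.1 (i) eq. (1.9) (p. 3)] -/
theorem IsBoundedWeakNSSolutionOn.galileanBoost_iff {I : Set ℝ} {hI : IsOpen I} {ν : ℝ}
    {u : ℝ → E → E} (c : E) :
    IsBoundedWeakNSSolutionOn I hI ν (fun t y => u t (y + t • c) - c) ↔
      IsBoundedWeakNSSolutionOn I hI ν u := by
  refine ⟨fun h => ?_, fun h => h.galileanBoost c⟩
  have h1 := h.galileanBoost (-c)
  have e : (fun t y => (fun t y => u t (y + t • c) - c) t (y + t • (-c)) - -c) = u := by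
    funext t y
    simp
  rwa [e] at h1

end Literature.Analysis.FluidPDE

end
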